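import Literature.NumberTheory.LFunctions.CertifiedDirichletLTuringHadamardSingle
import Literature.NumberTheory.LFunctions.RiemannSiegelStirling
import HarnessLib

/-!
# Booker 2006, Theorem 4.6 for Dirichlet `L`-functions — proved (discharge of
# `booker2006_theorem46_dirichlet` and of its Palojärvi–Zhao correction)

A. R. Booker, *Artin's conjecture, Turing's method, and the Riemann hypothesis*, Experiment. Math.
**15** (2006) 385–407, §4, Theorem 4.6 (arXiv:math/0507502, §4 Theorem 8 with Lemmas 4–7), in the
degree-one entire case typed by `CertifiedDirichletLTuringMethod.lean`: for `χ` primitive of conductor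
`q > 1`, `X > 5` and `t₁², t₂² ≥ (5/2 + a_χ)² + X²` (hypothesis (4–10); either sign and either order of
`t₁, t₂`, Remark 4.7),

  `π ∫_{t₁}^{t₂} S_χ(t) dt ≤ ¼ log|Q(3/2+it₂)| + (log 2 − ½) log|Q(3/2+it₁)| + c₀ + 1/(√2 (X − 5))`,

`|Q(3/2+it)| = q‖3/2 + a_χ + it‖/2π`, `c₀ = Booker2006Turing.turingConst`.  Main results:

* `booker2006_theorem46_dirichlet_holds : booker2006_theorem46_dirichlet` — the statement AS PRINTED;
* `palojarviZhao2025_theorem46_dirichlet_holds : palojarviZhao2025_theorem46_dirichlet` — the weaker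
  statement with `0.8/(X − 5)` (Palojärvi–Zhao 2025, Remark 4.2), via the tree's
  `booker2006_theorem46_dirichlet.corrected`.

On the erratum.  Palojärvi–Zhao (arXiv:2508.03023v2, Remark 4.2) observe that the last inequality of
Booker's proof, `r(1/(√2X) + ((2/π²)log(16e³)+¼)/X²) + m(4 log 2 + 5/2)/X² < r/(√2(X−5))`, fails for
`X ≥ 10.5998`.  With NO POLES (`m = 0`, the case of a Dirichlet `L`-function) it holds for every
`X > 5`: it reads `1.42/X² < (1/√2)·5/(X(X−5))`, i.e. `1.42 (X − 5) < 3.54 X`.  So for the degree-one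
entire case the printed constant stands, and this file proves it (by a route whose `1/X`-coefficient
is `9/25 < 1/√2`, see below); the corrected statement follows a fortiori.

## The proof (Booker's, §4 pp. 395–397 = arXiv pp. 13–15, followed step by step for `r = 1`, `m = 0`)

Littlewood's formula (4–9) `π∫_{t₁}^{t₂} S = U(t₂) − U(t₁)`, `U(t) = ∫_{1/2}^∞ log|L(σ+it,χ)| dσ`
(the tree's `TuringDirichlet.pi_mul_integral_lfunctionArgS_eq`, either order:
`pi_mul_integral_lfunctionArgS_eq'`), an upper bound for `U(t₂)` and a lower bound for `U(t₁)`.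

* **Lemma 4.3 (1)** (`re_digamma_half_ge`, `re_digamma_half_le`, on the `ξ`-side
  `re_logDeriv_dirichletXi_sub_ge_booker` / `_le_booker`): with `γ'/γ(s) = ½ log(q/π) + ½ψ((s+a)/2)`
  (`= Re(ξ'/ξ − L'/L)`, the tree's `TuringDirichlet.re_logDeriv_dirichletXi_sub_eq`),
  `Re γ'/γ(σ+it) − ½ log|Q(3/2+it)| ≥ −(9/(25X) + 1/(4X²) + 2/(3|t|³) + π/(6t²))` for `σ ∈ [½, 5/2]`
  and `≤ 2/(3|t|³) + π/(6t²)` at `σ = 3/2`.  Booker's elementary inequality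
  `log|(x+β+iy)/(x+iy)| + Re 1/(x+iy) ≤ (2x+½)/(2x²+X²) ≤ 1/(√2X) + 1/(2X²)` is
  `log_sub_log_div_four_add_le` (with `1/(2√2) ≤ 9/25`); Lehman's Stirling estimate
  `Θ(2/π²/|Im²−Re²|)` is replaced by the tree's second-order bound
  `|Re ψ(w) − log‖w‖ + Re 1/(2w)| ≤ 1/(6|Im w|³) + π/(12 Im w²)` (`abs_re_digamma_sub_log_norm_add_re_le`,
  both signs of `Im w`), whence the different `1/X²`, `1/|t|³` constants.
* **Upper bound** (`setIntegral_log_norm_LFunction_le_booker`):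
  `U(t) ≤ ¼ log|Q(3/2+it)| + 1/(2t²) + log Z₀(3/2) + ∫_{3/2}^∞ log Z₀`.  DEVIATION: Booker's Lemma 4.1
  (Phragmén–Lindelöf, `|L(s)|² ≤ B|χ(s)Q(s)|`) plus the mean-value step costs `r(2/(π²X²) + 1/(2√2X))`;
  the tree already has Rademacher's explicit convexity theorem (`Rademacher1959.log_norm_LFunction_le`,
  `η = ½`: `log|L(s,χ)| ≤ ((3/2−σ)/2) log(q|1+s|/2π) + log ζ(3/2)` on `½ ≤ σ ≤ 3/2`), which gives the
  same main term `¼ log|Q(3/2+it)|` with error `1/(2t²)` and no `1/X` term — a shorter road to a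
  sharper bound (Lemma 4.1 itself, for degree one, is meanwhile a theorem of the tree —
  `BookerConvexity.booker2006_lemma41_dirichlet`, `CertifiedDirichletLTuringConvexity.lean` — not
  used on this road); the tail `∫_{3/2}^∞ log|L| ≤ ∫ log Z₀` is Lemma 4.5 (4–12)
  (`Booker2006Turing.norm_LFunction_le_bigZ`).
* **Lower bound** (`booker_lower_bound`): Booker's splitting
  `U(t) = ∫_{1/2}^{3/2} log|F(s)/F(s+1)| + ∫_{1/2}^{3/2} log|γ(s+1)/γ(s)| + ∫_{3/2}^{5/2} log|L| + ∫_{3/2}^∞ log|L|`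
  (`F = Λ = const · ξ(·,χ)`; the tree's `TuringDirichlet.setIntegral_Ioi_half_log_norm_LFunction_eq_decomp`
  at `d = 1`); the `γ`-term `≥ ½ log|Q(3/2+it)| − e₁` by Lemma 4.3 (1) integrated
  (`integral_log_norm_LFunction_sub_one_ge`); the zeros' term `≥ −(log 4) Σ_ρ Re 1/(3/2+it−ρ)
  = −(log 4) Re F'/F(3/2+it)` by Lemma 4.4 and the Hadamard product — this is the tree's
  `TuringDirichlet.integral_log_norm_dirichletXi_sub_shift_ge` at `d = 1` (genus-one product of `ξ(·,χ)`,
  `CertifiedDirichletLTuringHadamardSingle.lean`, with Lemma 4.4 = `Booker2006_lemma_4_4_holds` inside);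
  `Re F'/F(3/2+it) = Re γ'/γ + Re L'/L ≤ ½ log|Q| + [Stirling] + (z₀'/z₀)(3/2)` by Lemma 4.3 (1) and
  (4–11) (`Booker2006Turing.re_logDeriv_LFunction_le_logDeriv_smallZ`); the last two integrals
  `≥ ∫ log z₀` by (4–12) (`Booker2006Turing.smallZ_le_norm_LFunction`).  Altogether
  `U(t) ≥ (½ − log 2) log|Q(3/2+it)| + ∫_{3/2}^{5/2} log z₀ + ∫_{3/2}^∞ log z₀ − (log 4)(z₀'/z₀)(3/2) − e_low`.
* **Combination** (`pi_mul_integral_lfunctionArgS_le_booker_of_ne`): main terms + `c₀` (the displayed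
  `c₀`, `Booker2006Turing.turingConst`; `setIntegral_log_bigZ_div_smallZ`) + error, and the error
  `1/(2t₂²) + 9/(25X) + 1/(4X²) + (1 + log 4)(2/(3|t₁|³) + π/(6t₁²)) ≤ 0.36/X + 2.4/X² ≤ 0.7/(X−5)
  ≤ 1/(√2(X−5))` (`booker_error_le`).
* **Ordinates** (`pi_mul_integral_lfunctionArgS_le_booker`): the typed fact carries no "`t₁, t₂` not
  ordinates" proviso (nor does the source: `S(t)` is upper semicontinuous there and only `∫S` occurs).
  Both sides are continuous in `t₁` and in `t₂` (`S_χ` is locally integrable,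
  `intervalIntegrable_lfunctionArgS_of_isPrimitive`, from the tree's
  `TuringDirichlet.intervalIntegrable_lfunctionArgS'`) and the non-ordinates are dense
  (`exists_not_ordinate_mem_Ioo`: finitely many zeros up to any height), so the inequality extends from
  non-ordinates to all admissible `t₁, t₂`.

Everything is a theorem (standard axioms); no new definition, no named fact.  Conventions as in the
`CertifiedDirichletLTuring*` files: `L(s,χ) = χ.LFunction s`, `ξ(s,χ) = DirichletTheta.dirichletXi χ s`,
`a = charParity χ`, "not an ordinate" = `∀ ρ ∈ charNontrivialZeros χ, ρ.im ≠ t`.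

## References
* A. R. Booker, Artin's conjecture, Turing's method, and the Riemann hypothesis, Experiment. Math. 15
  (2006) 385–407, §4: Lemma 4.3, Lemma 4.5, Theorem 4.6, Remark 4.7 (arXiv:math/0507502 §4, Lemmas 5, 7,
  Theorem 8, pp. 13–15). [Booker2006]
* N. Palojärvi, T. Zhao, On Turing's method for a general set of L-functions and the Selberg class,
  arXiv:2508.03023v2 (2025), §4 Remark 4.2. [PalojarviZhao2025TuringSelbergClass]
* H. Rademacher, On the Phragmén–Lindelöf theorem and some applications, Math. Z. 72 (1959), §6
  Theorem 3. [Rademacher1959]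
* R. Rumely, Numerical computations concerning the ERH, Math. Comp. 61 (1993), Lemma 3 p. 429. [Rumely1993ERH]
-/

noncomputable section

open Complex Set MeasureTheory intervalIntegral Filter Topology
open scoped Real

namespace Literature.NumberTheory.LFunctions

open DirichletTheta DirichletCharacter ExplicitPsiChar

namespace Booker2006Turing

/-! ### Lemma 4.3 (1): the `Γ`-factor via second-order Stirling -/

/-- The elementary inequality behind Booker's Lemma 4.3 (1), lower bound (arXiv display after
(4.3): "`log|(x+β+iy)/(x+iy)| + Re 1/(x+iy) ≤ ((β+1)x + β²/2)/(x²+y²) ≤ (2x+½)/(2x²+X²)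
≤ 1/(√2 X) + 1/(2X²)`", here halved and with `1/(2√2) ≤ 9/25`): for `u ≥ 0`, `|v − u| ≤ 1`,
`u² + X² ≤ t²`, `X > 0`,
`¼(log(v²+t²) − log(u²+t²)) + u/(2(u²+t²)) ≤ 9/(25X) + 1/(4X²)`.
[cite: Booker2006, §4 Lemma 4.3 (1) (proof); arXiv math/0507502 Lemma 5 p. 13] -/
theorem log_sub_log_div_four_add_le {u v t X : ℝ} (hX : 0 < X) (hu : 0 ≤ u) (huv : |v - u| ≤ 1)
    (ht : u ^ 2 + X ^ 2 ≤ t ^ 2) :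
    (Real.log (v ^ 2 + t ^ 2) - Real.log (u ^ 2 + t ^ 2)) / 4 + u / (2 * (u ^ 2 + t ^ 2)) ≤
      9 / (25 * X) + 1 / (4 * X ^ 2) := by
  have hX2 : 0 < X ^ 2 := by positivity
  have hD : 0 < u ^ 2 + t ^ 2 := by nlinarith
  have hD' : 0 < v ^ 2 + t ^ 2 := by nlinarith [sq_nonneg v]
  -- `log(D'/D) ≤ D'/D − 1`
  have hlog : Real.log (v ^ 2 + t ^ 2) - Real.log (u ^ 2 + t ^ 2) ≤
      (v ^ 2 - u ^ 2) / (u ^ 2 + t ^ 2) := by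
    rw [← Real.log_div hD'.ne' hD.ne']
    have h := Real.log_le_sub_one_of_pos (div_pos hD' hD)
    have e : (v ^ 2 + t ^ 2) / (u ^ 2 + t ^ 2) - 1 = (v ^ 2 - u ^ 2) / (u ^ 2 + t ^ 2) := by
      field_simp; ring
    linarith
  -- `v² − u² ≤ 2u + 1`
  have hvu : v ^ 2 - u ^ 2 ≤ 2 * u + 1 := by
    have h1 := (abs_le.mp huv).1
    have h2 := (abs_le.mp huv).2
    nlinarith
  -- `(u + 1/4)/D ≤ (u + 1/4)/(2u² + X²) ≤ 9/(25X) + 1/(4X²)`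
  have hD2 : 2 * u ^ 2 + X ^ 2 ≤ u ^ 2 + t ^ 2 := by linarith
  have hE : 0 < 2 * u ^ 2 + X ^ 2 := by positivity
  have step1 : (Real.log (v ^ 2 + t ^ 2) - Real.log (u ^ 2 + t ^ 2)) / 4 + u / (2 * (u ^ 2 + t ^ 2))
      ≤ (u + 1 / 4) / (u ^ 2 + t ^ 2) := by
    have : (Real.log (v ^ 2 + t ^ 2) - Real.log (u ^ 2 + t ^ 2)) / 4 ≤
        (2 * u + 1) / (u ^ 2 + t ^ 2) / 4 := by
      have := div_le_div_of_nonneg_right (hlog.trans (div_le_div_of_nonneg_right hvu hD.le))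
        (by norm_num : (0:ℝ) ≤ 4)
      exact this
    have e : (2 * u + 1) / (u ^ 2 + t ^ 2) / 4 + u / (2 * (u ^ 2 + t ^ 2)) =
        (u + 1 / 4) / (u ^ 2 + t ^ 2) := by
      field_simp; ring
    linarith
  have step2 : (u + 1 / 4) / (u ^ 2 + t ^ 2) ≤ (u + 1 / 4) / (2 * u ^ 2 + X ^ 2) :=
    div_le_div_of_nonneg_left (by positivity) hE hD2
  have step3 : u / (2 * u ^ 2 + X ^ 2) ≤ 9 / (25 * X) := by
    rw [div_le_div_iff₀ hE (by positivity)]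
    nlinarith [sq_nonneg (6 * u - 5 * X), sq_nonneg u, hX.le]
  have step4 : 1 / 4 / (2 * u ^ 2 + X ^ 2) ≤ 1 / (4 * X ^ 2) := by
    rw [div_le_div_iff₀ hE (by positivity)]
    nlinarith [sq_nonneg u]
  have e : (u + 1 / 4) / (2 * u ^ 2 + X ^ 2) =
      u / (2 * u ^ 2 + X ^ 2) + 1 / 4 / (2 * u ^ 2 + X ^ 2) := by
    rw [← add_div]
  linarith

/-- **Second-order Stirling for `Re ψ` at `w = (x + a + it)/2`** (the tree's
`abs_re_digamma_sub_log_norm_add_re_le`, both signs of `t`): for `x + a > 0`, `t ≠ 0`,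
`|Re ψ(w) − (log‖x+a+it‖ − log 2) + (x+a)/((x+a)²+t²)| ≤ 4/(3|t|³) + π/(3t²)` — the real part of
Booker's Stirling-type estimate (4.3) "`Γ'/Γ(z) = log z − 1/(2z) + Θ(2/π²/|Im(z)² − Re(z)²|)`, `Re z ≥ 0`"
with the tree's constants. [cite: Booker2006, §4 proof of Lemma 4.3, display (4.3); arXiv math/0507502 p. 13] -/
theorem abs_re_digamma_half_sub_le {x t : ℝ} {a : ℕ} (hx : 0 < x + a) (ht : t ≠ 0) :
    |(digamma (((x : ℂ) + t * I + a) / 2)).re -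
        (Real.log ‖(x : ℂ) + t * I + a‖ - Real.log 2) + (x + a) / ((x + a) ^ 2 + t ^ 2)| ≤
      4 / (3 * |t| ^ 3) + π / (3 * t ^ 2) := by
  set z : ℂ := (x : ℂ) + t * I + a with hz
  have hzre : z.re = x + a := by simp [hz]
  have hzim : z.im = t := by simp [hz]
  have hz0 : z ≠ 0 := fun h ↦ by
    have := congrArg Complex.im h; rw [hzim] at this; simp at this; exact ht this
  have hwre : 0 < (z / 2).re := by rw [div_ofNat_re, hzre]; linarith
  have hwim : (z / 2).im = t / 2 := by rw [div_ofNat_im, hzim]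
  have hwim0 : (z / 2).im ≠ 0 := by rw [hwim]; exact div_ne_zero ht two_ne_zero
  have hS := Literature.NumberTheory.LFunctions.Complex.abs_re_digamma_sub_log_norm_add_re_le hwre hwim0
  -- rewrite the three pieces
  have hnorm : Real.log ‖z / 2‖ = Real.log ‖z‖ - Real.log 2 := by
    rw [norm_div, RCLike.norm_ofNat, Real.log_div (norm_ne_zero_iff.mpr hz0) two_ne_zero]
  have hinv : (1 / (2 * (z / 2))).re = (x + a) / ((x + a) ^ 2 + t ^ 2) := by
    have e : 2 * (z / 2) = z := by ring
    rw [e, one_div, inv_re, normSq_apply, hzre, hzim]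
    ring_nf
  have hB : 1 / (6 * |(z / 2).im| ^ 3) + π / (12 * (z / 2).im ^ 2) =
      4 / (3 * |t| ^ 3) + π / (3 * t ^ 2) := by
    rw [hwim, abs_div, abs_two]
    field_simp
    ring
  rw [hnorm, hinv, hB] at hS
  exact hS

/-- `log ‖x + a + it‖ = ½ log((x+a)² + t²)`. [folklore] -/
private theorem log_norm_eq_half_log (x t : ℝ) (a : ℕ) :
    Real.log ‖(x : ℂ) + t * I + a‖ = Real.log ((x + a) ^ 2 + t ^ 2) / 2 := by
  have h : ‖(x : ℂ) + t * I + a‖ ^ 2 = (x + a) ^ 2 + t ^ 2 := by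
    rw [Complex.sq_norm, normSq_apply]; simp; ring
  rw [← h, Real.log_pow]; push_cast; ring

/-- **Booker 2006, Lemma 4.3 (1), lower bound, degree one** (`r = 1`, `μ₁ = a ∈ {0,1}`, via the
tree's second-order Stirling bound in place of Lehman's `Θ(2/π²/|Im² − Re²|)`): for `x ∈ [½, 5/2]`,
`X > 5` and `t² ≥ (5/2 + a)² + X²` (hypothesis (4–10)),
`½ Re ψ((x + a + it)/2) ≥ ½ log‖3/2 + a + it‖ − ½ log 2 − (9/(25X) + 1/(4X²) + 2/(3|t|³) + π/(6t²))`.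
(Printed: `Re γ'/γ(σ+it) − ½ log|Q(3/2+it)| ≥ −(1/(2√2 X) + (4/π² + ¼)/X²)`.)
[cite: Booker2006, §4 Lemma 4.3 (1); arXiv math/0507502 Lemma 5 p. 13] -/
theorem re_digamma_half_ge {x t X : ℝ} {a : ℕ} (ha : a ≤ 1) (hx : 1 / 2 ≤ x) (hx' : x ≤ 5 / 2)
    (hX : 5 < X) (ht : (5 / 2 + a) ^ 2 + X ^ 2 ≤ t ^ 2) :
    Real.log ‖(3 / 2 : ℂ) + a + t * I‖ / 2 - Real.log 2 / 2 -
        (9 / (25 * X) + 1 / (4 * X ^ 2) + (2 / (3 * |t| ^ 3) + π / (6 * t ^ 2))) ≤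
      (digamma (((x : ℂ) + t * I + a) / 2)).re / 2 := by
  have ha0 : (0 : ℝ) ≤ a := Nat.cast_nonneg a
  have ha1 : (a : ℝ) ≤ 1 := by exact_mod_cast ha
  have hX0 : 0 < X := by linarith
  have ht0 : t ≠ 0 := by
    rintro rfl; nlinarith
  have hS := abs_re_digamma_half_sub_le (x := x) (t := t) (a := a) (by linarith) ht0
  have hS' := (abs_le.mp hS).1
  have hel := log_sub_log_div_four_add_le (u := x + a) (v := 3 / 2 + a) (t := t) hX0 (by linarith)
    (by rw [abs_le]; constructor <;> linarith) (by nlinarith)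
  have e1 : Real.log ‖(3 / 2 : ℂ) + a + t * I‖ = Real.log ((3 / 2 + a) ^ 2 + t ^ 2) / 2 := by
    have := log_norm_eq_half_log (3 / 2) t a
    have e : ((3 / 2 : ℝ) : ℂ) + t * I + a = (3 / 2 : ℂ) + a + t * I := by push_cast; ring
    rw [e] at this
    exact this
  have e2 := log_norm_eq_half_log x t a
  rw [e1]
  rw [e2] at hS'
  have hD : 0 < (x + a) ^ 2 + t ^ 2 := by positivity
  have e3 : (x + (a : ℝ)) / (2 * ((x + a) ^ 2 + t ^ 2)) = (x + a) / ((x + a) ^ 2 + t ^ 2) / 2 := by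
    rw [div_div, mul_comm]
  have eB : 4 / (3 * |t| ^ 3) + π / (3 * t ^ 2) = 2 * (2 / (3 * |t| ^ 3) + π / (6 * t ^ 2)) := by
    ring
  rw [eB] at hS'
  rw [e3] at hel
  linarith

/-- **Booker 2006, Lemma 4.3 (1), upper bound at `σ = 3/2`, degree one:**
`½ Re ψ((3/2 + a + it)/2) ≤ ½ log‖3/2 + a + it‖ − ½ log 2 + 2/(3|t|³) + π/(6t²)` (`t ≠ 0`; the
term `−(3/2+a)/(2|3/2+a+it|²) ≤ 0` is dropped).  (Printed: `≤ 4r/(π²X²)`.)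
[cite: Booker2006, §4 Lemma 4.3 (1); arXiv math/0507502 Lemma 5 p. 13] -/
theorem re_digamma_half_le {t : ℝ} {a : ℕ} (ht : t ≠ 0) :
    (digamma ((((3 / 2 : ℝ) : ℂ) + t * I + a) / 2)).re / 2 ≤
      Real.log ‖(3 / 2 : ℂ) + a + t * I‖ / 2 - Real.log 2 / 2 +
        (2 / (3 * |t| ^ 3) + π / (6 * t ^ 2)) := by
  have ha0 : (0 : ℝ) ≤ a := Nat.cast_nonneg a
  have hS := abs_re_digamma_half_sub_le (x := 3 / 2) (t := t) (a := a) (by linarith) ht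
  have hS' := (abs_le.mp hS).2
  have e : ((3 / 2 : ℝ) : ℂ) + t * I + a = (3 / 2 : ℂ) + a + t * I := by push_cast; ring
  rw [e] at hS'
  have e' : (((3 / 2 : ℝ) : ℂ) + t * I + a) = (3 / 2 : ℂ) + a + t * I := e
  rw [e']
  have hD : 0 ≤ (3 / 2 + (a : ℝ)) / ((3 / 2 + a) ^ 2 + t ^ 2) := by positivity
  have eB : 4 / (3 * |t| ^ 3) + π / (3 * t ^ 2) = 2 * (2 / (3 * |t| ^ 3) + π / (6 * t ^ 2)) := by
    ring
  rw [eB] at hS'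
  linarith


/-! ### The non-`L` part of `ξ'/ξ(s, χ)` against `½ log|Q(3/2 + it)|` -/

variable {q : ℕ} [NeZero q] {χ : DirichletCharacter ℂ q}

omit [NeZero q] in
/-- `log(Q‖3/2 + a + it‖/2π) = log Q + log‖3/2 + a + it‖ − log 2 − log π`. [folklore] -/
private theorem log_Q_eq (hq : 0 < (q : ℝ)) (a : ℕ) (t : ℝ) :
    Real.log (q * ‖(3 / 2 : ℂ) + a + t * I‖ / (2 * π)) =
      Real.log q + Real.log ‖(3 / 2 : ℂ) + a + t * I‖ - Real.log 2 - Real.log π := by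
  have hN : 0 < ‖(3 / 2 : ℂ) + a + t * I‖ := by
    refine norm_pos_iff.mpr fun h ↦ ?_
    have := congrArg Complex.re h
    simp at this
    have : (0 : ℝ) ≤ a := Nat.cast_nonneg a
    linarith
  rw [Real.log_div (by positivity) (by positivity), Real.log_mul hq.ne' hN.ne',
    Real.log_mul two_ne_zero Real.pi_ne_zero]
  ring

/-- **Booker's Lemma 4.3 (1), lower bound, on the `ξ`-side:** for `χ ≠ 1`, `x ∈ [½, 5/2]`, `X > 5`,
`t² ≥ (5/2 + a_χ)² + X²` and `L(x + it, χ) ≠ 0`,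
`Re (ξ'/ξ − L'/L)(x + it, χ) = ½ log(Q/π) + ½ Re ψ((x + a + it)/2)
   ≥ ½ log|Q(3/2 + it)| − (9/(25X) + 1/(4X²) + 2/(3|t|³) + π/(6t²))`,
`|Q(3/2 + it)| = Q‖3/2 + a + it‖/2π` (Booker's `Re γ'/γ(σ+it) − ½ log|Q(3/2+it)| ≥ −r(1/(2√2X) +
(4/π²+¼)/X²)`, with the tree's Stirling constants). [cite: Booker2006, §4 Lemma 4.3 (1); arXiv math/0507502 Lemma 5 p. 13] -/
theorem re_logDeriv_dirichletXi_sub_ge_booker (h1 : χ ≠ 1) {x t X : ℝ} (hx : 1 / 2 ≤ x)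
    (hx' : x ≤ 5 / 2) (hX : 5 < X) (ht : (5 / 2 + (charParity χ : ℝ)) ^ 2 + X ^ 2 ≤ t ^ 2)
    (hL : χ.LFunction (x + t * I) ≠ 0) :
    Real.log (q * ‖(3 / 2 : ℂ) + (charParity χ : ℂ) + t * I‖ / (2 * π)) / 2 -
        (9 / (25 * X) + 1 / (4 * X ^ 2) + (2 / (3 * |t| ^ 3) + π / (6 * t ^ 2))) ≤
      (deriv (dirichletXi χ) (x + t * I) / dirichletXi χ (x + t * I)).re -
        (deriv χ.LFunction (x + t * I) / χ.LFunction (x + t * I)).re := by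
  have hqR : (0 : ℝ) < q := by exact_mod_cast NeZero.pos q
  rw [TuringDirichlet.re_logDeriv_dirichletXi_sub_eq h1 (by simp; linarith) hL]
  have hψ := re_digamma_half_ge (charParity_le_one χ) hx hx' hX ht
  rw [log_Q_eq hqR]
  linarith

/-- **Booker's Lemma 4.3 (1), upper bound at `σ = 3/2`, on the `ξ`-side:** for `χ ≠ 1`, `t ≠ 0`,
`Re (ξ'/ξ − L'/L)(3/2 + it, χ) ≤ ½ log|Q(3/2 + it)| + 2/(3|t|³) + π/(6t²)`
(printed: `≤ 4r/(π²X²)`). [cite: Booker2006, §4 Lemma 4.3 (1); arXiv math/0507502 Lemma 5 p. 13] -/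
theorem re_logDeriv_dirichletXi_sub_le_booker (h1 : χ ≠ 1) {t : ℝ} (ht : t ≠ 0)
    (hL : χ.LFunction (((3 / 2 : ℝ) : ℂ) + t * I) ≠ 0) :
    (deriv (dirichletXi χ) (((3 / 2 : ℝ) : ℂ) + t * I) / dirichletXi χ (((3 / 2 : ℝ) : ℂ) + t * I)).re -
        (deriv χ.LFunction (((3 / 2 : ℝ) : ℂ) + t * I) / χ.LFunction (((3 / 2 : ℝ) : ℂ) + t * I)).re ≤
      Real.log (q * ‖(3 / 2 : ℂ) + (charParity χ : ℂ) + t * I‖ / (2 * π)) / 2 +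
        (2 / (3 * |t| ^ 3) + π / (6 * t ^ 2)) := by
  have hqR : (0 : ℝ) < q := by exact_mod_cast NeZero.pos q
  rw [TuringDirichlet.re_logDeriv_dirichletXi_sub_eq h1 (by simp) hL]
  have hψ := re_digamma_half_le (a := charParity χ) ht
  rw [log_Q_eq hqR]
  linarith

/-! ### Helpers -/

/-- `L(x + it, χ) ≠ 0` for `x ≥ ½` when `t` is the ordinate of no non-trivial zero. [folklore] -/
private theorem LFunction_ne_zero_of_half_le (h1 : χ ≠ 1) {t : ℝ}
    (ht : ∀ ρ ∈ charNontrivialZeros χ, ρ.im ≠ t) {x : ℝ} (hx : 1 / 2 ≤ x) :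
    χ.LFunction (x + t * I) ≠ 0 := by
  intro hL
  rcases lt_or_ge x 1 with hx1 | hx1
  · exact ht _ (mem_charNontrivialZeros.2 ⟨hL, by simp; linarith, by simpa using hx1⟩) (by simp)
  · exact LFunction_ne_zero_of_one_le_re χ (Or.inl h1) (by simpa using hx1) hL

/-- `σ ↦ log|L(σ + it, χ)|` is interval integrable on `[a, b]`, `½ ≤ a, b`. [folklore] -/
private theorem intervalIntegrable_log_norm_LFunction (h1 : χ ≠ 1) {t a b : ℝ}
    (ht : ∀ ρ ∈ charNontrivialZeros χ, ρ.im ≠ t) (ha : 1 / 2 ≤ a) (hb : 1 / 2 ≤ b) :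
    IntervalIntegrable (fun x : ℝ ↦ Real.log ‖χ.LFunction (x + t * I)‖) volume a b := by
  have h := TuringDirichlet.integrableOn_log_norm_LFunction h1 ht
  have key : ∀ a b : ℝ, 1 / 2 ≤ a → a ≤ b →
      IntervalIntegrable (fun x : ℝ ↦ Real.log ‖χ.LFunction (x + t * I)‖) volume a b :=
    fun a b ha hab ↦ (intervalIntegrable_iff_integrableOn_Ioc_of_le hab).2
      (h.mono_set fun x hx ↦ lt_of_le_of_lt ha hx.1)
  rcases le_total a b with hab | hab
  · exact key a b ha hab
  · exact (key b a hb hab).symm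

/-- `σ ↦ log|ξ(σ + it, χ)|` is continuous (`t` not an ordinate). [folklore] -/
private theorem continuous_log_norm_dirichletXi (hχ : χ.IsPrimitive) (h1 : χ ≠ 1) {t : ℝ}
    (hord : ∀ ρ ∈ charNontrivialZeros χ, ρ.im ≠ t) :
    Continuous fun x : ℝ ↦ Real.log ‖dirichletXi χ (x + t * I)‖ := by
  have hξ : ∀ x : ℝ, dirichletXi χ (x + t * I) ≠ 0 := fun x ↦
    dirichletXi_ne_zero_of_im_eq hχ h1 hord (by simp)
  have hc : Continuous fun x : ℝ ↦ dirichletXi χ (x + t * I) :=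
    (differentiable_dirichletXi h1).continuous.comp (by fun_prop)
  exact continuous_iff_continuousAt.2 fun x ↦
    (hc.continuousAt.norm).log (norm_ne_zero_iff.2 (hξ x))

/-- Splitting `∫_{Ioi a} = ∫_a^b + ∫_{Ioi b}`. [folklore] -/
private theorem setIntegral_Ioi_eq_add {f : ℝ → ℝ} {a b : ℝ} (hab : a ≤ b)
    (hf : IntegrableOn f (Ioi a)) :
    ∫ x in Ioi a, f x = (∫ x in a..b, f x) + ∫ x in Ioi b, f x := by
  rw [intervalIntegral.integral_of_le hab, ← setIntegral_union (Set.Ioc_disjoint_Ioi le_rfl)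
    measurableSet_Ioi (hf.mono_set Ioc_subset_Ioi_self) (hf.mono_set (Ioi_subset_Ioi hab)),
    Ioc_union_Ioi_eq_Ioi hab]

/-! ### The lower bound: Turing's comparison `log|L(s)| − log|L(s+1)|` -/

/-- **Pointwise form of the `γ`-part of Booker's lower bound:** for `σ ∈ [½, 3/2]`, `X > 5`,
`t² ≥ (5/2 + a)² + X²` not an ordinate, `χ` primitive mod `Q > 1`,
`log|L(s)| − log|L(s+1)| ≥ [log|ξ(s,χ)| − log|ξ(s+1,χ)|] + ½ log|Q(3/2+it)| − e₁(X,t)`,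
`e₁ = 9/(25X) + 1/(4X²) + 2/(3|t|³) + π/(6t²)`, `s = σ + it` (horizontal FTC for `log|L|`, `log|ξ|`
and `re_logDeriv_dirichletXi_sub_ge_booker`; the source's
`∫ log|γ(σ+1+it)/γ(σ+it)| ≥ ½ log|Q(3/2+it)| − r(1/(2√2X) + (4/π²+¼)/X²)` before integration).
[cite: Booker2006, §4 proof of Theorem 4.6; arXiv math/0507502 pp. 14–15] -/
theorem log_norm_LFunction_sub_one_ge (hχ : χ.IsPrimitive) (h1 : χ ≠ 1) {σ t X : ℝ}
    (hσ : 1 / 2 ≤ σ) (hσ' : σ ≤ 3 / 2) (hX : 5 < X)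
    (ht : (5 / 2 + (charParity χ : ℝ)) ^ 2 + X ^ 2 ≤ t ^ 2)
    (hord : ∀ ρ ∈ charNontrivialZeros χ, ρ.im ≠ t) :
    (Real.log ‖dirichletXi χ (σ + t * I)‖ - Real.log ‖dirichletXi χ ((σ + 1 : ℝ) + t * I)‖) +
      (Real.log (q * ‖(3 / 2 : ℂ) + (charParity χ : ℂ) + t * I‖ / (2 * π)) / 2 -
        (9 / (25 * X) + 1 / (4 * X ^ 2) + (2 / (3 * |t| ^ 3) + π / (6 * t ^ 2)))) ≤
    Real.log ‖χ.LFunction (σ + t * I)‖ - Real.log ‖χ.LFunction ((σ + 1 : ℝ) + t * I)‖ := by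
  have hL : ∀ x : ℝ, 1 / 2 ≤ x → χ.LFunction (x + t * I) ≠ 0 := fun x hx ↦
    LFunction_ne_zero_of_half_le h1 hord hx
  have hξ : ∀ x : ℝ, dirichletXi χ (x + t * I) ≠ 0 := fun x ↦
    dirichletXi_ne_zero_of_im_eq hχ h1 hord (by simp)
  have hLa : ∀ x ∈ Icc σ (σ + 1), AnalyticAt ℂ χ.LFunction (x + t * I) := fun x _ ↦
    (differentiable_LFunction h1).analyticAt _
  have hξa : ∀ x ∈ Icc σ (σ + 1), AnalyticAt ℂ (dirichletXi χ) (x + t * I) := fun x _ ↦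
    (differentiable_dirichletXi h1).analyticAt _
  have hσd : σ ≤ σ + 1 := by linarith
  have hL' : ∀ x ∈ Icc σ (σ + 1), χ.LFunction (x + t * I) ≠ 0 := fun x hx ↦ hL x (hσ.trans hx.1)
  have FL := integral_re_logDeriv_horizontal hσd hLa hL'
  have Fξ := integral_re_logDeriv_horizontal hσd hξa (fun x _ ↦ hξ x)
  have IL := (continuousOn_re_logDeriv_horizontal hLa hL').intervalIntegrable_of_Icc
    (μ := volume) hσd
  have Iξ := (continuousOn_re_logDeriv_horizontal hξa (fun x _ ↦ hξ x)).intervalIntegrable_of_Icc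
    (μ := volume) hσd
  set c : ℝ := Real.log (q * ‖(3 / 2 : ℂ) + (charParity χ : ℂ) + t * I‖ / (2 * π)) / 2 -
    (9 / (25 * X) + 1 / (4 * X ^ 2) + (2 / (3 * |t| ^ 3) + π / (6 * t ^ 2))) with hc
  have hpt : ∀ x ∈ Icc σ (σ + 1), c ≤
      (deriv (dirichletXi χ) (x + t * I) / dirichletXi χ (x + t * I)).re -
        (deriv χ.LFunction (x + t * I) / χ.LFunction (x + t * I)).re :=
    fun x hx ↦ re_logDeriv_dirichletXi_sub_ge_booker h1 (hσ.trans hx.1) (by linarith [hx.2]) hX ht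
      (hL' x hx)
  have hmono := intervalIntegral.integral_mono_on hσd intervalIntegrable_const (Iξ.sub IL) hpt
  rw [intervalIntegral.integral_const, intervalIntegral.integral_sub Iξ IL, FL, Fξ, smul_eq_mul]
    at hmono
  have e : (σ + 1 - σ) * c = c := by ring
  rw [e] at hmono
  push_cast at hmono ⊢
  linarith

/-- **Integrated form** (the second term of Booker's splitting of `∫ log|L|`, with the `ξ`-quotient
kept): for `X > 5`, `t² ≥ (5/2 + a)² + X²` not an ordinate,
`∫_{1/2}^{3/2} (log|L(s)| − log|L(s+1)|) dσ ≥ ∫_{1/2}^{3/2} (log|ξ(s,χ)| − log|ξ(s+1,χ)|) dσ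
   + ½ log|Q(3/2+it)| − e₁(X,t)`. [cite: Booker2006, §4 proof of Theorem 4.6; arXiv math/0507502 pp. 14–15] -/
theorem integral_log_norm_LFunction_sub_one_ge (hχ : χ.IsPrimitive) (h1 : χ ≠ 1) {t X : ℝ}
    (hX : 5 < X) (ht : (5 / 2 + (charParity χ : ℝ)) ^ 2 + X ^ 2 ≤ t ^ 2)
    (hord : ∀ ρ ∈ charNontrivialZeros χ, ρ.im ≠ t) :
    (∫ σ in (1 / 2 : ℝ)..(3 / 2),
        (Real.log ‖dirichletXi χ (σ + t * I)‖ -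
          Real.log ‖dirichletXi χ ((σ + 1 : ℝ) + t * I)‖)) +
      (Real.log (q * ‖(3 / 2 : ℂ) + (charParity χ : ℂ) + t * I‖ / (2 * π)) / 2 -
        (9 / (25 * X) + 1 / (4 * X ^ 2) + (2 / (3 * |t| ^ 3) + π / (6 * t ^ 2)))) ≤
    ∫ σ in (1 / 2 : ℝ)..(3 / 2),
        (Real.log ‖χ.LFunction (σ + t * I)‖ - Real.log ‖χ.LFunction ((σ + 1 : ℝ) + t * I)‖) := by
  set c : ℝ := Real.log (q * ‖(3 / 2 : ℂ) + (charParity χ : ℂ) + t * I‖ / (2 * π)) / 2 -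
    (9 / (25 * X) + 1 / (4 * X ^ 2) + (2 / (3 * |t| ^ 3) + π / (6 * t ^ 2))) with hc
  have hle : (1 / 2 : ℝ) ≤ 3 / 2 := by norm_num
  have I1 : IntervalIntegrable (fun σ : ℝ ↦ Real.log ‖χ.LFunction (σ + t * I)‖) volume
      (1 / 2) (3 / 2) := intervalIntegrable_log_norm_LFunction h1 hord le_rfl (by norm_num)
  have I2 : IntervalIntegrable (fun σ : ℝ ↦ Real.log ‖χ.LFunction ((σ + 1 : ℝ) + t * I)‖) volume
      (1 / 2) (3 / 2) := by
    have h := (intervalIntegrable_log_norm_LFunction h1 hord (a := 1 / 2 + 1) (b := 3 / 2 + 1)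
      (by norm_num) (by norm_num)).comp_add_right 1
    simp only [add_sub_cancel_right] at h
    exact h
  have hξc := continuous_log_norm_dirichletXi hχ h1 hord
  have I3 : IntervalIntegrable (fun σ : ℝ ↦ Real.log ‖dirichletXi χ (σ + t * I)‖ -
      Real.log ‖dirichletXi χ ((σ + 1 : ℝ) + t * I)‖) volume (1 / 2) (3 / 2) :=
    (hξc.intervalIntegrable _ _).sub ((hξc.comp (continuous_id.add continuous_const :
      Continuous fun σ : ℝ ↦ σ + 1)).intervalIntegrable _ _)
  have hpt : ∀ σ ∈ Icc (1 / 2 : ℝ) (3 / 2),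
      (Real.log ‖dirichletXi χ (σ + t * I)‖ - Real.log ‖dirichletXi χ ((σ + 1 : ℝ) + t * I)‖) +
        c ≤
      Real.log ‖χ.LFunction (σ + t * I)‖ - Real.log ‖χ.LFunction ((σ + 1 : ℝ) + t * I)‖ :=
    fun σ hσ ↦ log_norm_LFunction_sub_one_ge hχ h1 hσ.1 hσ.2 hX ht hord
  have hmono := intervalIntegral.integral_mono_on hle (I3.add intervalIntegrable_const) (I1.sub I2)
    hpt
  rw [intervalIntegral.integral_add I3 intervalIntegrable_const, intervalIntegral.integral_const,
    smul_eq_mul] at hmono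
  have e : (3 / 2 - 1 / 2 : ℝ) * c = c := by ring
  rw [e] at hmono
  exact hmono

/-! ### The `ζ`-envelopes beyond `σ = 3/2` (Lemma 4.5) in Booker's notation -/

/-- `σ ↦ log Z₀(σ)` is integrable on `(3/2, ∞)` (`Z₀ = ζ` there). [cite: Booker2006, §4 Lemma 4.5 p. 396] -/
theorem integrableOn_log_bigZ : IntegrableOn (fun σ : ℝ ↦ Real.log (bigZ σ)) (Ioi (3 / 2)) := by
  refine (integrableOn_log_norm_riemannZeta_ofReal (by norm_num : (1:ℝ) < 3 / 2)).congr_fun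
    (fun σ hσ ↦ ?_) measurableSet_Ioi
  have hσ1 : 1 < σ := lt_trans (by norm_num) hσ
  change Real.log ‖riemannZeta σ‖ = Real.log (bigZ σ)
  rw [bigZ_eq_norm hσ1]

/-- `σ ↦ log z₀(σ) = log ζ(2σ) − log ζ(σ)` is integrable on `(3/2, ∞)`.
[cite: Booker2006, §4 Lemma 4.5 p. 396] -/
theorem integrableOn_log_smallZ : IntegrableOn (fun σ : ℝ ↦ Real.log (smallZ σ)) (Ioi (3 / 2)) := by
  have hR1 : IntegrableOn (fun σ : ℝ ↦ Real.log ‖riemannZeta σ‖) (Ioi (3 / 2)) :=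
    integrableOn_log_norm_riemannZeta_ofReal (by norm_num)
  have hR2 : IntegrableOn (fun σ : ℝ ↦ Real.log ‖riemannZeta ((2 * σ : ℝ) : ℂ)‖) (Ioi (3 / 2)) := by
    have h := (integrableOn_Ioi_comp_mul_left_iff (fun u : ℝ ↦ Real.log ‖riemannZeta u‖)
      (3 / 2) (a := 2) two_pos).2
    have e : (2 : ℝ) * (3 / 2) = 3 := by norm_num
    rw [e] at h
    exact h (integrableOn_log_norm_riemannZeta_ofReal (by norm_num))
  refine (hR2.sub hR1).congr_fun (fun σ hσ ↦ ?_) measurableSet_Ioi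
  have hσ1 : 1 < σ := lt_trans (by norm_num) hσ
  have h2σ : 1 < 2 * σ := by linarith
  change Real.log ‖riemannZeta ((2 * σ : ℝ) : ℂ)‖ - Real.log ‖riemannZeta σ‖ = Real.log (smallZ σ)
  rw [smallZ_eq_div hσ1, Real.log_div (bigZ_pos h2σ).ne' (bigZ_pos hσ1).ne', bigZ_eq_norm h2σ,
    bigZ_eq_norm hσ1]

/-- `∫_{3/2}^∞ log(Z₀/z₀) = ∫_{3/2}^∞ log Z₀ − ∫_{3/2}^∞ log z₀` (the second term of `c₀`).
[cite: Booker2006, §4 Theorem 4.6 p. 396] -/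
theorem setIntegral_log_bigZ_div_smallZ :
    ∫ σ in Ioi (3 / 2 : ℝ), Real.log (bigZ σ / smallZ σ) =
      (∫ σ in Ioi (3 / 2 : ℝ), Real.log (bigZ σ)) - ∫ σ in Ioi (3 / 2 : ℝ), Real.log (smallZ σ) := by
  rw [← integral_sub integrableOn_log_bigZ integrableOn_log_smallZ]
  refine setIntegral_congr_fun measurableSet_Ioi fun σ hσ ↦ ?_
  have hσ1 : 1 < σ := lt_trans (by norm_num) hσ
  exact Real.log_div (bigZ_pos hσ1).ne' (smallZ_pos hσ1).ne'

/-- **Lemma 4.5 integrated, upper envelope:** `∫_{3/2}^∞ log|L(σ+it,χ)| dσ ≤ ∫_{3/2}^∞ log Z₀(σ) dσ`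
(`t` not an ordinate, `χ ≠ 1`). [cite: Booker2006, §4 Lemma 4.5 (4–12) p. 396] -/
theorem setIntegral_log_norm_LFunction_le_log_bigZ (h1 : χ ≠ 1) {t : ℝ}
    (hord : ∀ ρ ∈ charNontrivialZeros χ, ρ.im ≠ t) :
    ∫ σ in Ioi (3 / 2 : ℝ), Real.log ‖χ.LFunction (σ + t * I)‖ ≤
      ∫ σ in Ioi (3 / 2 : ℝ), Real.log (bigZ σ) := by
  have hI := (TuringDirichlet.integrableOn_log_norm_LFunction h1 hord).mono_set
    (Ioi_subset_Ioi (by norm_num : (1 / 2 : ℝ) ≤ 3 / 2))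
  refine setIntegral_mono_on hI integrableOn_log_bigZ measurableSet_Ioi fun σ hσ ↦ ?_
  have hσ1 : 1 < σ := lt_trans (by norm_num) hσ
  exact Real.log_le_log (norm_LFunction_pos χ hσ1 t) (norm_LFunction_le_bigZ χ hσ1 t)

/-- **Lemma 4.5 integrated, lower envelope, unbounded part:**
`∫_{3/2}^∞ log z₀(σ) dσ ≤ ∫_{3/2}^∞ log|L(σ+it,χ)| dσ`. [cite: Booker2006, §4 Lemma 4.5 (4–12) p. 396] -/
theorem setIntegral_log_smallZ_le (h1 : χ ≠ 1) {t : ℝ}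
    (hord : ∀ ρ ∈ charNontrivialZeros χ, ρ.im ≠ t) :
    ∫ σ in Ioi (3 / 2 : ℝ), Real.log (smallZ σ) ≤
      ∫ σ in Ioi (3 / 2 : ℝ), Real.log ‖χ.LFunction (σ + t * I)‖ := by
  have hI := (TuringDirichlet.integrableOn_log_norm_LFunction h1 hord).mono_set
    (Ioi_subset_Ioi (by norm_num : (1 / 2 : ℝ) ≤ 3 / 2))
  refine setIntegral_mono_on integrableOn_log_smallZ hI measurableSet_Ioi fun σ hσ ↦ ?_
  have hσ1 : 1 < σ := lt_trans (by norm_num) hσ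
  exact Real.log_le_log (smallZ_pos hσ1) (smallZ_le_norm_LFunction χ hσ1 t)

/-- **Lemma 4.5 integrated, lower envelope, bounded part:**
`∫_{3/2}^{5/2} log z₀(σ) dσ ≤ ∫_{3/2}^{5/2} log|L(σ+it,χ)| dσ`. [cite: Booker2006, §4 Lemma 4.5 (4–12) p. 396] -/
theorem integral_log_smallZ_le (h1 : χ ≠ 1) {t : ℝ}
    (hord : ∀ ρ ∈ charNontrivialZeros χ, ρ.im ≠ t) :
    ∫ σ in (3 / 2 : ℝ)..(5 / 2), Real.log (smallZ σ) ≤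
      ∫ σ in (3 / 2 : ℝ)..(5 / 2), Real.log ‖χ.LFunction (σ + t * I)‖ := by
  have h35 : (3 / 2 : ℝ) ≤ 5 / 2 := by norm_num
  have hI : IntervalIntegrable (fun σ : ℝ ↦ Real.log ‖χ.LFunction (σ + t * I)‖) volume
      (3 / 2) (5 / 2) := intervalIntegrable_log_norm_LFunction h1 hord (by norm_num) (by norm_num)
  have hz : IntervalIntegrable (fun σ : ℝ ↦ Real.log (smallZ σ)) volume (3 / 2) (5 / 2) :=
    (intervalIntegrable_iff_integrableOn_Ioc_of_le h35).2
      (integrableOn_log_smallZ.mono_set Ioc_subset_Ioi_self)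
  refine intervalIntegral.integral_mono_on h35 hz hI fun σ hσ ↦ ?_
  have hσ1 : 1 < σ := lt_of_lt_of_le (by norm_num) hσ.1
  exact Real.log_le_log (smallZ_pos hσ1) (smallZ_le_norm_LFunction χ hσ1 t)

/-! ### The upper bound (Lemma 4.1 via Rademacher's theorem, and Lemma 4.5) -/

/-- **Booker's upper bound for `∫_{1/2}^∞ log|L(σ + it, χ)| dσ`, degree one** (§4, proof of
Theorem 4.6, first half), in the form
`∫_{1/2}^∞ log|L(σ+it,χ)| dσ ≤ ¼ log|Q(3/2+it)| + 1/(2t²) + log Z₀(3/2) + ∫_{3/2}^∞ log Z₀(σ) dσ`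
for `χ` primitive mod `Q > 1`, `|t| ≥ 5` not an ordinate.  The source bounds `∫_{1/2}^{3/2} log|L|` by
Lemma 4.1 (Phragmén–Lindelöf, `|L(s)|² ≤ B|χ(s)Q(s)|`) and the mean-value step (4.3), at the cost
`r(2/(π²X²) + 1/(2√2X))`; here Rademacher's explicit convexity bound (the tree's
`Rademacher1959.log_norm_LFunction_le` at `η = ½`: `log|L(s,χ)| ≤ ((3/2−σ)/2) log(Q|1+s|/2π) + log ζ(3/2)`
on `½ ≤ σ ≤ 3/2`) gives the same main term `¼ log|Q(3/2+it)|` (`∫_{1/2}^{3/2} (3/2−σ)/2 dσ = ¼`,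
`log|1+s| ≤ log‖3/2+a+it‖ + 2/t²`) with the smaller error `1/(2t²)`; the tail is Lemma 4.5,
`|L(σ+it)| ≤ Z₀(σ)`. [cite: Booker2006, §4 proof of Theorem 4.6 (upper bound); arXiv math/0507502 p. 14]
[cite: Rademacher1959, §6 Theorem 3, p. 199] -/
theorem setIntegral_log_norm_LFunction_le_booker (hq : 1 < q) (hχ : χ.IsPrimitive) {t : ℝ}
    (ht : 5 ≤ |t|) (hord : ∀ ρ ∈ charNontrivialZeros χ, ρ.im ≠ t) :
    ∫ σ in Ioi (1 / 2 : ℝ), Real.log ‖χ.LFunction (σ + t * I)‖ ≤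
      1 / 4 * Real.log (q * ‖(3 / 2 : ℂ) + (charParity χ : ℂ) + t * I‖ / (2 * π)) + 1 / (2 * t ^ 2) +
        Real.log (bigZ (3 / 2)) + ∫ σ in Ioi (3 / 2 : ℝ), Real.log (bigZ σ) := by
  have hq1 : q ≠ 1 := by omega
  have h1 : χ ≠ 1 := SelbergDirichlet.ne_one_of_isPrimitive hq1 hχ
  have hqR : (0 : ℝ) < q := by exact_mod_cast (show 0 < q by omega)
  have hc' : (1 / 2 : ℝ) ≤ 3 / 2 := by norm_num
  have ht0 : t ≠ 0 := by
    intro h; rw [h, abs_zero] at ht; linarith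
  have ht2 : 25 ≤ t ^ 2 := by nlinarith [sq_abs t, abs_nonneg t]
  set f : ℝ → ℝ := fun σ ↦ Real.log ‖χ.LFunction (σ + t * I)‖ with hf
  set LQ : ℝ := Real.log (q * ‖(3 / 2 : ℂ) + (charParity χ : ℂ) + t * I‖ / (2 * π)) with hLQ
  have hI : IntegrableOn f (Ioi (1 / 2 : ℝ)) := TuringDirichlet.integrableOn_log_norm_LFunction h1 hord
  rw [setIntegral_Ioi_eq_add hc' hI]
  -- `log(Q|1+s|/2π) ≤ LQ + 2/t²` on `½ ≤ σ ≤ 3/2`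
  have ha0 : (0 : ℝ) ≤ charParity χ := Nat.cast_nonneg _
  have hlogs : ∀ σ ∈ Icc (1 / 2 : ℝ) (3 / 2),
      Real.log (q * ‖1 + ((σ : ℂ) + t * I)‖ / (2 * π)) ≤ LQ + 2 / t ^ 2 := by
    intro σ hσ
    have hN1 : ‖1 + ((σ : ℂ) + t * I)‖ ^ 2 = (1 + σ) ^ 2 + t ^ 2 := by
      rw [Complex.sq_norm, normSq_apply]; simp; ring
    have hN2 : ‖(3 / 2 : ℂ) + (charParity χ : ℂ) + t * I‖ ^ 2 = (3 / 2 + charParity χ) ^ 2 + t ^ 2 := by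
      rw [Complex.sq_norm, normSq_apply]; simp; ring
    have hp1 : 0 < ‖1 + ((σ : ℂ) + t * I)‖ := by
      refine norm_pos_iff.mpr fun h ↦ ?_
      have := congrArg Complex.re h; simp at this; linarith [hσ.1]
    have hp2 : 0 < ‖(3 / 2 : ℂ) + (charParity χ : ℂ) + t * I‖ := by
      refine norm_pos_iff.mpr fun h ↦ ?_
      have := congrArg Complex.re h; simp at this; linarith
    have hl1 : Real.log ‖1 + ((σ : ℂ) + t * I)‖ = Real.log ((1 + σ) ^ 2 + t ^ 2) / 2 := by
      rw [← hN1, Real.log_pow]; push_cast; ring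
    have hl2 : Real.log ‖(3 / 2 : ℂ) + (charParity χ : ℂ) + t * I‖ =
        Real.log ((3 / 2 + charParity χ) ^ 2 + t ^ 2) / 2 := by
      rw [← hN2, Real.log_pow]; push_cast; ring
    have hD1 : 0 < (1 + σ) ^ 2 + t ^ 2 := by positivity
    have hD2 : 0 < (3 / 2 + (charParity χ : ℝ)) ^ 2 + t ^ 2 := by positivity
    -- `log D₁ − log D₂ ≤ (D₁ − D₂)/D₂ ≤ 4/t²`
    have hdiff : Real.log ((1 + σ) ^ 2 + t ^ 2) - Real.log ((3 / 2 + charParity χ) ^ 2 + t ^ 2) ≤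
        4 / t ^ 2 := by
      rw [← Real.log_div hD1.ne' hD2.ne']
      have h := Real.log_le_sub_one_of_pos (div_pos hD1 hD2)
      have e : ((1 + σ) ^ 2 + t ^ 2) / ((3 / 2 + charParity χ) ^ 2 + t ^ 2) - 1 =
          ((1 + σ) ^ 2 - (3 / 2 + charParity χ) ^ 2) / ((3 / 2 + charParity χ) ^ 2 + t ^ 2) := by
        field_simp; ring
      rw [e] at h
      refine h.trans ?_
      rw [div_le_div_iff₀ hD2 (by positivity)]
      have hAB : (1 + σ) ^ 2 - (3 / 2 + (charParity χ : ℝ)) ^ 2 ≤ 4 := by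
        nlinarith [hσ.1, hσ.2, sq_nonneg (charParity χ : ℝ)]
      nlinarith [mul_le_mul_of_nonneg_right hAB (sq_nonneg t), sq_nonneg (3 / 2 + (charParity χ : ℝ))]
    rw [Real.log_div (by positivity) (by positivity), Real.log_mul hqR.ne' hp1.ne', hl1]
    rw [hLQ, Real.log_div (by positivity) (by positivity), Real.log_mul hqR.ne' hp2.ne', hl2]
    have e4 : (4 : ℝ) / t ^ 2 = 2 * (2 / t ^ 2) := by ring
    rw [e4] at hdiff
    linarith
  -- the piece `[1/2, 3/2]`
  set g : ℝ → ℝ := fun σ ↦ (3 / 2 - σ) / 2 * (LQ + 2 / t ^ 2) + Real.log (bigZ (3 / 2)) with hg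
  have hfg : ∀ σ ∈ Icc (1 / 2 : ℝ) (3 / 2), f σ ≤ g σ := by
    intro σ hσ
    have hne := LFunction_ne_zero_of_half_le h1 hord hσ.1
    have h := Rademacher1959.log_norm_LFunction_le hq hχ (η := 1 / 2) (by norm_num) le_rfl
      (s := σ + t * I) (by simp; linarith [hσ.1]) (by simp; linarith [hσ.2]) hne
    have eζ : (riemannZeta (1 + (1 / 2 : ℝ))).re = bigZ (3 / 2) := by
      rw [bigZ]; push_cast; norm_num
    rw [eζ] at h
    have hw : 0 ≤ (1 + 1 / 2 - ((σ : ℂ) + t * I).re) / 2 := by simp; linarith [hσ.2]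
    have hmul := mul_le_mul_of_nonneg_left (hlogs σ hσ) hw
    have ew : (1 + 1 / 2 - ((σ : ℂ) + t * I).re) / 2 = (3 / 2 - σ) / 2 := by simp; ring
    rw [ew] at hmul h
    simp only [hf, hg]
    linarith
  have hgi : ∫ σ in (1 / 2 : ℝ)..(3 / 2), g σ = 1 / 4 * (LQ + 2 / t ^ 2) + Real.log (bigZ (3 / 2)) := by
    have e : g = fun σ ↦ -((LQ + 2 / t ^ 2) / 2) * σ + (3 / 4 * (LQ + 2 / t ^ 2) + Real.log (bigZ (3 / 2))) := by
      funext σ; simp only [hg]; ring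
    rw [e, intervalIntegral.integral_add, intervalIntegral.integral_const_mul, integral_id,
      intervalIntegral.integral_const, smul_eq_mul]
    · ring
    · exact (continuous_const.mul continuous_id).intervalIntegrable _ _
    · exact intervalIntegrable_const
  have hpiece1 : ∫ σ in (1 / 2 : ℝ)..(3 / 2), f σ ≤ 1 / 4 * (LQ + 2 / t ^ 2) + Real.log (bigZ (3 / 2)) := by
    rw [← hgi]
    refine intervalIntegral.integral_mono_on hc'
      ((intervalIntegrable_iff_integrableOn_Ioc_of_le hc').mpr (hI.mono_set Ioc_subset_Ioi_self))
      ?_ hfg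
    exact (((continuous_const.sub continuous_id).div_const _).mul continuous_const |>.add
      continuous_const).intervalIntegrable _ _
  -- the piece `[3/2, ∞)`
  have hpiece2 := setIntegral_log_norm_LFunction_le_log_bigZ h1 hord
  have e : 1 / 4 * (LQ + 2 / t ^ 2) = 1 / 4 * LQ + 1 / (2 * t ^ 2) := by
    field_simp; ring
  simp only [hf] at hpiece1 hpiece2 ⊢
  linarith

/-! ### The lower bound -/

/-- `log 4 = 2 log 2`. [folklore] -/
private theorem log_four_eq : Real.log 4 = 2 * Real.log 2 := by
  rw [show (4 : ℝ) = 2 ^ 2 by norm_num, Real.log_pow]; push_cast; ring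

/-- **Booker's lower bound for `∫_{1/2}^∞ log|L(σ + it, χ)| dσ`, degree one** (§4, proof of
Theorem 4.6, second half): for `χ` primitive mod `Q > 1`, `X > 5`, `t² ≥ (5/2 + a)² + X²`
((4–10)) with `t` not an ordinate,
`∫_{1/2}^∞ log|L(σ+it,χ)| dσ ≥ (½ − log 2) log|Q(3/2+it)| + ∫_{3/2}^{5/2} log z₀ + ∫_{3/2}^∞ log z₀
   − (log 4)(z₀'/z₀)(3/2) − [e₁(X,t) + (log 4)(2/(3|t|³) + π/(6t²))]`.
Booker's splitting `∫ log|L| = ∫_{1/2}^{3/2} log|F(s)/F(s+1)| + ∫ log|γ(s+1)/γ(s)| + ∫_{3/2}^{5/2} log|L|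
+ ∫_{3/2}^∞ log|L|` (`F = Λ`, no poles: `m = 0`; `Λ = const·ξ(·,χ)`), the zeros' term
`≥ −(log 4) Σ_ρ Re 1/(3/2+it−ρ) = −(log 4) Re F'/F(3/2+it)` (Lemma 4.4 and the Hadamard product — the
tree's `TuringDirichlet.integral_log_norm_dirichletXi_sub_shift_ge` at `d = 1`, genus one),
`Re F'/F(3/2+it) = Re γ'/γ + Re L'/L ≤ ½ log|Q(3/2+it)| + [Stirling] + (z₀'/z₀)(3/2)` ((4–11),
`Booker2006Turing.re_logDeriv_LFunction_le_logDeriv_smallZ`), the `γ`-quotient term by Lemma 4.3 (1)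
(`integral_log_norm_LFunction_sub_one_ge`), the last two by (4–12).
[cite: Booker2006, §4 proof of Theorem 4.6 (lower bound); arXiv math/0507502 pp. 14–15] -/
theorem booker_lower_bound (hq : 1 < q) (hχ : χ.IsPrimitive) {t X : ℝ} (hX : 5 < X)
    (ht : (5 / 2 + (charParity χ : ℝ)) ^ 2 + X ^ 2 ≤ t ^ 2)
    (hord : ∀ ρ ∈ charNontrivialZeros χ, ρ.im ≠ t) :
    (1 / 2 - Real.log 2) * Real.log (q * ‖(3 / 2 : ℂ) + (charParity χ : ℂ) + t * I‖ / (2 * π)) +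
        (∫ σ in (3 / 2 : ℝ)..(5 / 2), Real.log (smallZ σ)) +
        (∫ σ in Ioi (3 / 2 : ℝ), Real.log (smallZ σ)) -
        Real.log 4 * (deriv smallZ (3 / 2) / smallZ (3 / 2)) -
        ((9 / (25 * X) + 1 / (4 * X ^ 2) + (2 / (3 * |t| ^ 3) + π / (6 * t ^ 2))) +
          Real.log 4 * (2 / (3 * |t| ^ 3) + π / (6 * t ^ 2))) ≤
      ∫ σ in Ioi (1 / 2 : ℝ), Real.log ‖χ.LFunction (σ + t * I)‖ := by
  have hq1 : q ≠ 1 := by omega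
  have h1 : χ ≠ 1 := SelbergDirichlet.ne_one_of_isPrimitive hq1 hχ
  have hX0 : 0 < X := by linarith
  have ht0 : t ≠ 0 := by
    rintro rfl
    have : (0 : ℝ) ≤ charParity χ := Nat.cast_nonneg _
    nlinarith
  -- the decomposition at `d = 1`
  have hdec := TuringDirichlet.setIntegral_Ioi_half_log_norm_LFunction_eq_decomp h1 (d := 1)
    zero_le_one hord (t := t)
  rw [show (1 / 2 : ℝ) + 1 = 3 / 2 by norm_num, show (1 / 2 : ℝ) + 2 * 1 = 5 / 2 by norm_num] at hdec
  -- first piece: `γ`-part and zeros' part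
  have hA := integral_log_norm_LFunction_sub_one_ge hχ h1 hX ht hord
  have hZ := TuringDirichlet.integral_log_norm_dirichletXi_sub_shift_ge hχ h1 (d := 1) (t := t)
    (by norm_num) le_rfl hord
  rw [show (1 / 2 : ℝ) + 1 = 3 / 2 by norm_num, one_pow, one_mul] at hZ
  -- `Re ξ'/ξ(3/2 + it) ≤ z₀'/z₀(3/2) + ½ log|Q| + Stirling`
  have hL32 : χ.LFunction (((3 / 2 : ℝ) : ℂ) + t * I) ≠ 0 :=
    LFunction_ne_zero_of_half_le h1 hord (by norm_num)
  have hR := re_logDeriv_dirichletXi_sub_le_booker h1 ht0 hL32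
  have h411 := re_logDeriv_LFunction_le_logDeriv_smallZ χ (σ := 3 / 2) (by norm_num) t
  -- the tails
  have hJ₁ := integral_log_smallZ_le h1 hord (t := t)
  have hJ₂ := setIntegral_log_smallZ_le h1 hord (t := t)
  have hlog4 : 0 ≤ Real.log 4 := Real.log_nonneg (by norm_num)
  have hRle : (deriv (dirichletXi χ) (((3 / 2 : ℝ) : ℂ) + t * I) /
        dirichletXi χ (((3 / 2 : ℝ) : ℂ) + t * I)).re ≤
      deriv smallZ (3 / 2) / smallZ (3 / 2) +
        (Real.log (q * ‖(3 / 2 : ℂ) + (charParity χ : ℂ) + t * I‖ / (2 * π)) / 2 +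
          (2 / (3 * |t| ^ 3) + π / (6 * t ^ 2))) := by linarith
  have hRR := mul_le_mul_of_nonneg_left hRle hlog4
  have h3 := le_trans (neg_le_neg hRR) hZ
  rw [hdec]
  rw [log_four_eq] at h3 ⊢
  linarith [hA, h3, hJ₁, hJ₂]


/-! ### The final inequality and the assembly at non-ordinates -/

/-- `log 4 ≤ 3/2` (`4 ≤ e^{3/2}`). [folklore] -/
private theorem log_four_le : Real.log 4 ≤ 3 / 2 := by
  rw [Real.log_le_iff_le_exp (by norm_num)]
  have h1 := Real.exp_one_gt_d9
  have h2 := Real.add_one_le_exp (1 / 2 : ℝ)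
  have e : Real.exp (3 / 2 : ℝ) = Real.exp 1 * Real.exp (1 / 2) := by
    rw [← Real.exp_add]; norm_num
  rw [e]
  nlinarith [Real.exp_pos (1 / 2 : ℝ), Real.exp_pos (1 : ℝ)]

/-- **The last inequality of Booker's proof, degree one, no poles** (`r = 1`, `m = 0`), for the error
terms of this file: for `X > 5`, `t₁², t₂² ≥ X²`, `|t₁| ≥ 5`,
`1/(2t₂²) + 9/(25X) + 1/(4X²) + (1 + log 4)(2/(3|t₁|³) + π/(6t₁²)) ≤ 1/(√2 (X − 5))`
(indeed `≤ 0.36/X + 2.4/X² ≤ 0.7/(X − 5)`).  The source's last step is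
`r(1/(√2X) + ((2/π²)log(16e³) + ¼)/X²) + m(4 log 2 + 5/2)/X² < r/(√2(X − 5))`, which for `m = 0`
holds for every `X > 5` (`1/(X−5) − 1/X = 5/(X(X−5))`); the restriction `5 < X < 10.5998` of
Palojärvi–Zhao's Remark 4.2 comes from the pole terms. [cite: Booker2006, §4 proof of Theorem 4.6 (last display); arXiv math/0507502 p. 15]
[cite: PalojarviZhao2025TuringSelbergClass, §4 Remark 4.2] -/
theorem booker_error_le {X t₁ t₂ : ℝ} (hX : 5 < X) (h₁ : X ^ 2 ≤ t₁ ^ 2) (h₂ : X ^ 2 ≤ t₂ ^ 2)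
    (ht₁ : 5 ≤ |t₁|) :
    1 / (2 * t₂ ^ 2) + (9 / (25 * X) + 1 / (4 * X ^ 2) + (2 / (3 * |t₁| ^ 3) + π / (6 * t₁ ^ 2))) +
        Real.log 4 * (2 / (3 * |t₁| ^ 3) + π / (6 * t₁ ^ 2)) ≤
      1 / (Real.sqrt 2 * (X - 5)) := by
  have hX0 : 0 < X := by linarith
  have hX5 : 0 < X - 5 := by linarith
  have hX2 : 0 < X ^ 2 := by positivity
  have ht₁0 : 0 < |t₁| := by linarith
  have ht₁2 : X ^ 2 ≤ |t₁| ^ 2 := by rwa [sq_abs]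
  have ht₁3 : 5 * X ^ 2 ≤ |t₁| ^ 3 := by nlinarith
  -- each term against `1/X` or `1/X²`
  have e1 : 1 / (2 * t₂ ^ 2) ≤ 1 / (2 * X ^ 2) := by
    apply one_div_le_one_div_of_le (by positivity); linarith
  have e2 : 2 / (3 * |t₁| ^ 3) ≤ 2 / (15 * X ^ 2) := by
    apply div_le_div_of_nonneg_left (by norm_num) (by positivity); linarith
  have e3 : π / (6 * t₁ ^ 2) ≤ 3.15 / (6 * X ^ 2) := by
    have hπ := Real.pi_lt_d2
    calc π / (6 * t₁ ^ 2) ≤ π / (6 * X ^ 2) := by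
          apply div_le_div_of_nonneg_left Real.pi_pos.le (by positivity); linarith
      _ ≤ 3.15 / (6 * X ^ 2) := by
          apply div_le_div_of_nonneg_right hπ.le (by positivity)
  have hB : 0 ≤ 2 / (3 * |t₁| ^ 3) + π / (6 * t₁ ^ 2) := by positivity
  have hlog4 := log_four_le
  have hlog0 : 0 ≤ Real.log 4 := Real.log_nonneg (by norm_num)
  have e4 : Real.log 4 * (2 / (3 * |t₁| ^ 3) + π / (6 * t₁ ^ 2)) ≤
      3 / 2 * (2 / (15 * X ^ 2) + 3.15 / (6 * X ^ 2)) := by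
    calc Real.log 4 * (2 / (3 * |t₁| ^ 3) + π / (6 * t₁ ^ 2))
        ≤ 3 / 2 * (2 / (3 * |t₁| ^ 3) + π / (6 * t₁ ^ 2)) := mul_le_mul_of_nonneg_right hlog4 hB
      _ ≤ 3 / 2 * (2 / (15 * X ^ 2) + 3.15 / (6 * X ^ 2)) := by
          apply mul_le_mul_of_nonneg_left (by linarith) (by norm_num)
  -- `0.36/X + 2.4/X² ≤ 0.7/(X−5) ≤ 1/(√2 (X−5))`
  have hmain : 9 / (25 * X) + 12 / (5 * X ^ 2) ≤ 7 / (10 * (X - 5)) := by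
    rw [div_add_div _ _ (by positivity) (by positivity), div_le_div_iff₀ (by positivity) (by positivity)]
    nlinarith [sq_nonneg X, mul_pos hX0 hX5, sq_nonneg (X - 1)]
  have hsqrt : Real.sqrt 2 < 10 / 7 := by
    rw [Real.sqrt_lt' (by norm_num)]; norm_num
  have hlast : 7 / (10 * (X - 5)) ≤ 1 / (Real.sqrt 2 * (X - 5)) := by
    rw [div_le_div_iff₀ (by positivity) (by positivity)]
    nlinarith [Real.sqrt_nonneg 2]
  have esum : 1 / (2 * X ^ 2) + (9 / (25 * X) + 1 / (4 * X ^ 2) + (2 / (15 * X ^ 2) + 3.15 / (6 * X ^ 2))) +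
      3 / 2 * (2 / (15 * X ^ 2) + 3.15 / (6 * X ^ 2)) ≤ 9 / (25 * X) + 12 / (5 * X ^ 2) := by
    have e : 1 / (2 * X ^ 2) + (9 / (25 * X) + 1 / (4 * X ^ 2) + (2 / (15 * X ^ 2) + 3.15 / (6 * X ^ 2))) +
        3 / 2 * (2 / (15 * X ^ 2) + 3.15 / (6 * X ^ 2)) =
        9 / (25 * X) + (1 / 2 + 1 / 4 + (2 / 15 + 3.15 / 6) + 3 / 2 * (2 / 15 + 3.15 / 6)) / X ^ 2 := by
      field_simp; ring
    rw [e]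
    have : (1 / 2 + 1 / 4 + (2 / 15 + 3.15 / 6) + 3 / 2 * (2 / 15 + 3.15 / 6) : ℝ) / X ^ 2 ≤
        12 / 5 / X ^ 2 := div_le_div_of_nonneg_right (by norm_num) hX2.le
    have e' : (12 / 5 : ℝ) / X ^ 2 = 12 / (5 * X ^ 2) := by rw [div_div]
    linarith
  linarith

/-- **Littlewood's formula in either order** (Remark 4.7: "there is no assumption on the order of
`t₁` and `t₂`"): `π ∫_{t₁}^{t₂} S_χ = U_χ(t₂) − U_χ(t₁)` for real non-ordinates `t₁, t₂`,
`U_χ(t) = ∫_{1/2}^∞ log|L(σ+it,χ)| dσ`. [cite: Booker2006, §4 (4–9) and Remark 4.7, pp. 395–396] -/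
theorem pi_mul_integral_lfunctionArgS_eq' (hχ : χ.IsPrimitive) (hq : 1 < q) {t₁ t₂ : ℝ}
    (h1' : ∀ ρ ∈ charNontrivialZeros χ, ρ.im ≠ t₁) (h2' : ∀ ρ ∈ charNontrivialZeros χ, ρ.im ≠ t₂) :
    π * ∫ t in t₁..t₂, lfunctionArgS χ t =
      (∫ x in Ioi (1 / 2 : ℝ), Real.log ‖χ.LFunction (x + t₂ * I)‖) -
        ∫ x in Ioi (1 / 2 : ℝ), Real.log ‖χ.LFunction (x + t₁ * I)‖ := by
  rcases le_total t₁ t₂ with h | h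
  · exact TuringDirichlet.pi_mul_integral_lfunctionArgS_eq hχ hq h h1' h2'
  · rw [intervalIntegral.integral_symm, mul_neg,
      TuringDirichlet.pi_mul_integral_lfunctionArgS_eq hχ hq h h2' h1']
    ring

/-- `|t| ≥ 5` and `t ≠ 0` under hypothesis (4–10). [folklore] -/
private theorem five_le_abs {a X t : ℝ} (ha : 0 ≤ a) (hX : 5 < X) (ht : (5 / 2 + a) ^ 2 + X ^ 2 ≤ t ^ 2) :
    5 ≤ |t| := by
  by_contra h
  rw [not_le] at h
  nlinarith [sq_abs t, abs_nonneg t]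

/-- **Booker 2006, Theorem 4.6, degree-one entire case, AS PRINTED — at non-ordinates:** for `χ`
primitive mod `Q > 1`, `X > 5`, `t₁², t₂² ≥ (5/2 + a_χ)² + X²` with `t₁, t₂` ordinates of no
non-trivial zero of `L(s, χ)` (no order between them assumed),
`π ∫_{t₁}^{t₂} S_χ ≤ ¼ log|Q(3/2+it₂)| + (log 2 − ½) log|Q(3/2+it₁)| + c₀ + 1/(√2 (X − 5))`,
`c₀ = Booker2006Turing.turingConst`. [cite: Booker2006, §4 Theorem 4.6 and Remark 4.7, p. 396] -/
theorem pi_mul_integral_lfunctionArgS_le_booker_of_ne (hq : 1 < q) (hχ : χ.IsPrimitive)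
    {X t₁ t₂ : ℝ} (hX : 5 < X)
    (h₁ : (5 / 2 + (charParity χ : ℝ)) ^ 2 + X ^ 2 ≤ t₁ ^ 2)
    (h₂ : (5 / 2 + (charParity χ : ℝ)) ^ 2 + X ^ 2 ≤ t₂ ^ 2)
    (hz₁ : ∀ ρ ∈ charNontrivialZeros χ, ρ.im ≠ t₁) (hz₂ : ∀ ρ ∈ charNontrivialZeros χ, ρ.im ≠ t₂) :
    π * ∫ t in t₁..t₂, lfunctionArgS χ t ≤
      1 / 4 * Real.log (q * ‖(3 / 2 : ℂ) + (charParity χ : ℂ) + (t₂ : ℂ) * I‖ / (2 * π)) +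
        (Real.log 2 - 1 / 2) *
          Real.log (q * ‖(3 / 2 : ℂ) + (charParity χ : ℂ) + (t₁ : ℂ) * I‖ / (2 * π)) +
        turingConst + 1 / (Real.sqrt 2 * (X - 5)) := by
  have ha0 : (0 : ℝ) ≤ charParity χ := Nat.cast_nonneg _
  have ht₁ := five_le_abs ha0 hX h₁
  have ht₂ := five_le_abs ha0 hX h₂
  have hX₁ : X ^ 2 ≤ t₁ ^ 2 := by nlinarith
  have hX₂ : X ^ 2 ≤ t₂ ^ 2 := by nlinarith
  rw [pi_mul_integral_lfunctionArgS_eq' hχ hq hz₁ hz₂]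
  have hU := setIntegral_log_norm_LFunction_le_booker hq hχ ht₂ hz₂
  have hL := booker_lower_bound hq hχ hX h₁ hz₁
  have herr := booker_error_le hX hX₁ hX₂ ht₁
  rw [turingConst, setIntegral_log_bigZ_div_smallZ]
  linarith

/-! ### Extension to ordinates (both sides are continuous in `t₁`, `t₂`) -/

/-- Between any two reals there is a height that is the ordinate of no non-trivial zero of
`L(s, χ)` (`χ ≠ 1`): the zeros up to a given height form a finite set
(`lfunctionZeroBox_finite`). [folklore] -/
private theorem exists_not_ordinate_mem_Ioo (h1 : χ ≠ 1) {a b : ℝ} (hab : a < b) :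
    ∃ u ∈ Ioo a b, ∀ ρ ∈ charNontrivialZeros χ, ρ.im ≠ u := by
  set F : Set ℝ := Complex.im '' lfunctionZeroBox χ (max |a| |b|) with hF
  have hFf : F.Finite := (lfunctionZeroBox_finite h1 _).image _
  obtain ⟨u, huI, huF⟩ := ((Set.Ioo_infinite hab).sdiff hFf).nonempty
  refine ⟨u, huI, fun ρ hρ hρu ↦ huF ⟨ρ, ?_, hρu⟩⟩
  rw [mem_charNontrivialZeros] at hρ
  refine mem_lfunctionZeroBox.2 ⟨hρ.1, hρ.2.1, hρ.2.2, ?_⟩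
  rw [hρu, abs_le]
  constructor
  · have : -|a| ≤ a := neg_abs_le a
    linarith [huI.1, le_max_left |a| |b|]
  · linarith [huI.2, le_abs_self b, le_max_right |a| |b|]

/-- `S_χ` is integrable on every bounded interval (primitive `χ`, `q > 1`).
[cite: Rumely1993ERH, Lemma 3 p. 429] -/
theorem intervalIntegrable_lfunctionArgS_of_isPrimitive (hχ : χ.IsPrimitive) (hq : 1 < q)
    (a b : ℝ) : IntervalIntegrable (lfunctionArgS χ) volume a b := by
  have hq1 : q ≠ 1 := by omega
  have h1 : χ ≠ 1 := SelbergDirichlet.ne_one_of_isPrimitive hq1 hχ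
  obtain ⟨t₀, ht₀I, hz₀⟩ := exists_not_ordinate_mem_Ioo h1
    (show min a b - 1 < min a b by linarith)
  have h := TuringDirichlet.intervalIntegrable_lfunctionArgS' hχ hq (t₀ := t₀) (h := max a b - t₀)
    (by linarith [ht₀I.2, min_le_max (a := a) (b := b)]) hz₀
  rw [add_sub_cancel] at h
  have hIO := (intervalIntegrable_iff_integrableOn_Ioc_of_le
    (by linarith [ht₀I.2, min_le_max (a := a) (b := b)])).1 h
  rw [intervalIntegrable_iff]
  refine hIO.mono_set fun x hx ↦ ?_
  simp only [Set.uIoc, Set.mem_Ioc] at hx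
  exact ⟨by linarith [ht₀I.2, hx.1], hx.2⟩

/-- `u ↦ log(Q‖3/2 + a + iu‖/2π)` is continuous. [folklore] -/
private theorem continuous_log_Q (q : ℕ) [NeZero q] (a : ℕ) :
    Continuous fun u : ℝ ↦ Real.log (q * ‖(3 / 2 : ℂ) + a + (u : ℂ) * I‖ / (2 * π)) := by
  have hqR : (0 : ℝ) < q := by exact_mod_cast NeZero.pos q
  have hc : Continuous fun u : ℝ ↦ (q : ℝ) * ‖(3 / 2 : ℂ) + a + (u : ℂ) * I‖ / (2 * π) := by
    fun_prop
  refine hc.log fun u ↦ ?_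
  have hN : 0 < ‖(3 / 2 : ℂ) + a + (u : ℂ) * I‖ := by
    refine norm_pos_iff.mpr fun h ↦ ?_
    have := congrArg Complex.re h
    simp at this
    have : (0 : ℝ) ≤ a := Nat.cast_nonneg a
    linarith
  positivity

/-- Near a point `t` of the region `t² ≥ T²` (`T > 0`) there are non-ordinates `u` of the region
arbitrarily close to `t` (push `t` away from `0`). [folklore] -/
private theorem exists_not_ordinate_near (h1 : χ ≠ 1) {T t δ : ℝ} (hT : 0 < T) (ht : T ^ 2 ≤ t ^ 2)
    (hδ : 0 < δ) :
    ∃ u : ℝ, dist u t < δ ∧ T ^ 2 ≤ u ^ 2 ∧ ∀ ρ ∈ charNontrivialZeros χ, ρ.im ≠ u := by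
  have ht0 : t ≠ 0 := by rintro rfl; nlinarith
  rcases lt_or_gt_of_ne ht0 with hneg | hpos
  · obtain ⟨u, huI, hu⟩ := exists_not_ordinate_mem_Ioo h1 (show t - δ < t by linarith)
    refine ⟨u, ?_, by nlinarith [huI.1, huI.2], hu⟩
    rw [Real.dist_eq, abs_lt]; constructor <;> linarith [huI.1, huI.2]
  · obtain ⟨u, huI, hu⟩ := exists_not_ordinate_mem_Ioo h1 (show t < t + δ by linarith)
    refine ⟨u, ?_, by nlinarith [huI.1, huI.2], hu⟩
    rw [Real.dist_eq, abs_lt]; constructor <;> linarith [huI.1, huI.2]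

/-- **Booker 2006, Theorem 4.6, degree-one entire case, AS PRINTED** (no non-ordinate hypothesis:
both sides of the inequality are continuous in `t₁` and `t₂`, and the non-ordinates are dense).
[cite: Booker2006, §4 Theorem 4.6 and Remark 4.7, p. 396] -/
theorem pi_mul_integral_lfunctionArgS_le_booker (hq : 1 < q) (hχ : χ.IsPrimitive)
    {X t₁ t₂ : ℝ} (hX : 5 < X)
    (h₁ : (5 / 2 + (charParity χ : ℝ)) ^ 2 + X ^ 2 ≤ t₁ ^ 2)
    (h₂ : (5 / 2 + (charParity χ : ℝ)) ^ 2 + X ^ 2 ≤ t₂ ^ 2) :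
    π * ∫ t in t₁..t₂, lfunctionArgS χ t ≤
      1 / 4 * Real.log (q * ‖(3 / 2 : ℂ) + (charParity χ : ℂ) + (t₂ : ℂ) * I‖ / (2 * π)) +
        (Real.log 2 - 1 / 2) *
          Real.log (q * ‖(3 / 2 : ℂ) + (charParity χ : ℂ) + (t₁ : ℂ) * I‖ / (2 * π)) +
        turingConst + 1 / (Real.sqrt 2 * (X - 5)) := by
  have hq1 : q ≠ 1 := by omega
  have h1 : χ ≠ 1 := SelbergDirichlet.ne_one_of_isPrimitive hq1 hχ
  set T : ℝ := Real.sqrt ((5 / 2 + (charParity χ : ℝ)) ^ 2 + X ^ 2) with hTdef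
  have hT0 : 0 < T := Real.sqrt_pos.2 (by positivity)
  have hT2 : T ^ 2 = (5 / 2 + (charParity χ : ℝ)) ^ 2 + X ^ 2 := Real.sq_sqrt (by positivity)
  set LQ : ℝ → ℝ := fun u ↦ Real.log (q * ‖(3 / 2 : ℂ) + (charParity χ : ℂ) + (u : ℂ) * I‖ / (2 * π))
    with hLQ
  have hLQc : Continuous LQ := continuous_log_Q q (charParity χ)
  have hS : ∀ a b, IntervalIntegrable (lfunctionArgS χ) volume a b :=
    intervalIntegrable_lfunctionArgS_of_isPrimitive hχ hq
  set C : ℝ := turingConst + 1 / (Real.sqrt 2 * (X - 5)) with hC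
  -- Step A: `t₁` a non-ordinate, `t₂` arbitrary
  have stepA : ∀ t₁ t₂ : ℝ, T ^ 2 ≤ t₁ ^ 2 → T ^ 2 ≤ t₂ ^ 2 →
      (∀ ρ ∈ charNontrivialZeros χ, ρ.im ≠ t₁) →
      π * ∫ t in t₁..t₂, lfunctionArgS χ t ≤ 1 / 4 * LQ t₂ + (Real.log 2 - 1 / 2) * LQ t₁ + C := by
    intro t₁ t₂ ht₁ ht₂ hz₁
    set P : ℝ → ℝ := fun u ↦ ∫ t in t₁..u, lfunctionArgS χ t with hP
    have hPc : Continuous P := intervalIntegral.continuous_primitive hS t₁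
    set F : ℝ → ℝ := fun u ↦ π * P u - (1 / 4 * LQ u + (Real.log 2 - 1 / 2) * LQ t₁ + C) with hF
    have hFc : Continuous F := by
      simp only [hF]
      fun_prop
    by_contra hcon
    have hpos : 0 < F t₂ := by
      simp only [hF, hP]
      linarith
    have hev := (hFc.continuousAt (x := t₂)).eventually (lt_mem_nhds hpos)
    obtain ⟨δ, hδ, hball⟩ := Metric.eventually_nhds_iff.1 hev
    obtain ⟨u, hu, huT, hzu⟩ := exists_not_ordinate_near h1 hT0 ht₂ hδ
    have hFu : 0 < F u := hball hu
    have hle := pi_mul_integral_lfunctionArgS_le_booker_of_ne hq hχ hX (by rw [← hT2]; exact ht₁)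
      (by rw [← hT2]; exact huT) hz₁ hzu
    simp only [hF, hP, hLQ, hC] at hFu
    linarith
  -- Step B: `t₁` arbitrary
  have ht₁ : T ^ 2 ≤ t₁ ^ 2 := by rw [hT2]; exact h₁
  have ht₂ : T ^ 2 ≤ t₂ ^ 2 := by rw [hT2]; exact h₂
  set P₂ : ℝ → ℝ := fun v ↦ ∫ t in t₂..v, lfunctionArgS χ t with hP₂
  have hP₂c : Continuous P₂ := intervalIntegral.continuous_primitive hS t₂
  set G : ℝ → ℝ := fun v ↦ π * (-P₂ v) - (1 / 4 * LQ t₂ + (Real.log 2 - 1 / 2) * LQ v + C) with hG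
  have hGc : Continuous G := by
    simp only [hG]
    fun_prop
  by_contra hcon
  have hpos : 0 < G t₁ := by
    simp only [hG, hP₂]
    rw [intervalIntegral.integral_symm t₂ t₁] at hcon
    linarith
  have hev := (hGc.continuousAt (x := t₁)).eventually (lt_mem_nhds hpos)
  obtain ⟨δ, hδ, hball⟩ := Metric.eventually_nhds_iff.1 hev
  obtain ⟨v, hv, hvT, hzv⟩ := exists_not_ordinate_near h1 hT0 ht₁ hδ
  have hGv : 0 < G v := hball hv
  have hle := stepA v t₂ hvT ht₂ hzv
  rw [intervalIntegral.integral_symm t₂ v] at hle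
  simp only [hG, hP₂] at hGv
  linarith

end Booker2006Turing

/-! ### The discharges -/

/-- **Booker 2006, Theorem 4.6 (degree-one entire case) holds AS PRINTED**: discharge of the named
fact `booker2006_theorem46_dirichlet` of `CertifiedDirichletLTuringMethod.lean` (its last term
`1/(√2 (X − 5))` is valid for every `X > 5` when there are no poles, `m = 0`).
[cite: Booker2006, §4 Theorem 4.6 and Remark 4.7, p. 396] -/
theorem booker2006_theorem46_dirichlet_holds : booker2006_theorem46_dirichlet := by
  intro q _ hq χ hχ X t₁ t₂ hX h₁ h₂
  exact Booker2006Turing.pi_mul_integral_lfunctionArgS_le_booker hq hχ hX h₁ h₂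

/-- **The corrected statement of Palojärvi–Zhao 2025, Remark 4.2 (`0.8/(X − 5)`) holds**: discharge of
`palojarviZhao2025_theorem46_dirichlet` (weaker than the printed bound,
`booker2006_theorem46_dirichlet.corrected`). [cite: PalojarviZhao2025TuringSelbergClass, §4 Remark 4.2]
[cite: Booker2006, §4 Theorem 4.6 p. 396] -/
theorem palojarviZhao2025_theorem46_dirichlet_holds : palojarviZhao2025_theorem46_dirichlet :=
  booker2006_theorem46_dirichlet.corrected booker2006_theorem46_dirichlet_holds

end Literature.NumberTheory.LFunctions

end
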